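import Summits.CriticalPhenomena.PercolationContinuityZ3.Theorems.PercNearOneGluingNoHeavyQuantLightSliceCore
import HarnessLib

/-!
# QUANT lane R8, T-DEC: THE POOLED RESIDUE OF `LightSliceCore` — `LightSliceLowCross` and `LightSliceWide`, the only instances of the
# light-slice core that are NOT settled piece-wise by landed cell lemmas (census-2 g59; the assembly is `…QuantLightSliceAssembly`)

builds on p205010 (kernel theorem, internal audit signed; external expert review pending)

Statement file (`--supports stmt-CriticalPhenomena-4575`), QUANT lane seat prim-quant-census-2 (gen 59), rung R8 of
`run/shared/lean/prim/quant/LADDER.md`.  Two `@[conjecture]` definitions; standard axioms, no sorries.  Memo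
`run/shared/lean/prim/quant/prim-quant-census-2-g59/ASSEMBLY-G59.md`.

THE SPLIT.  `LawDec.LightSliceCore` (census-2 g58, statement of record for (II), README V295) asks that the light slice
`lconv M₁ M₂ (TP[l₁′, h₁′; γ₁]) (atomLaw x T₂ j l₂ h₂ l₂′ h₂′)` be DEC at `(T₁ + T₂, j)`.  It is the mixture of the pieces
E = light ⊗ expensive cell and C = light ⊗ cheap cell (`lightSlice_decAtT_of_pieces`).  `…QuantLightSlicePieces` proves from LANDED lemmas
(arm-2 g31, typer g23, lead g26) that piece E is DEC in the WHOLE core and piece C is DEC unless its top cell `h₁′ + h₂′` is a giant AND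
(its upper cross cell `h₁′ + l₂′` is a conv-low OR the cheap cell is more than 4 times as long as the light one).  The two statements below
are exactly these leftover instances, with the conclusion of `LightSliceCore` (the POOLED light slice — piece-wise they are false in part):
* `LawDec.LightSliceLowCross` — binder of `LightSliceCore` + `j + 1 ≤ h₁′ + h₂′` + `2(h₁′ + l₂′) < T₁ + T₂` (census-1's pattern LLG /
  the lead's word LLMG; EXACT CENSUS census-2 g59 `code/assembly_census.py`, M ≤ 6, 7 floors, ½+¼ grids: 1 934 of 193 607 core instances,
  558 of them NOT piece-wise — e.g. `x = 3/4`, side 1 = atom `(0,3;1,2)` at `T₁ = 5/2`, side 2 = `(0,5;1,5)` at `T₂ = 4`, `j = 6` — and ALL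
  light-slice DEC; lead g27 N78: 61 / 36 080 at M ≤ 5, all LLMG).
* `LawDec.LightSliceWide` — binder + `j + 1 ≤ h₁′ + h₂′` + `T₁ + T₂ ≤ 2(h₁′ + l₂′)` + `4(h₁′ − l₁′) < h₂′ − l₂′` (extreme-aspect light ⊗ light,
  arm-2 g31's excluded regime; census: 204 core instances at M ≤ 6, all piece-wise there, but the standalone piece C FAILS at floor `x < 0.2955…`
  from aspect 7 on — raw-cell scan `out/wide`: 1 608 / 806 352, first `x = 1/5`, cells `(0,1)` at `1/8` and `(0,7)` at `7/8`, `j = 7` — so at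
  larger tops this class is pooled as well; the light slice itself has 0 failures in every literal test of `LightSliceCore`, incl. kit j161118
  with span ratios up to 30).
`…QuantLightSliceAssembly`: `LightSliceLowCross → LightSliceWide → LightSliceCore`, hence `… → GatedConvEmptyFree → FarTreeRow`.

[this work]; nothing here is cited as a published result.  The gluing rows served [cite: KozmaNitzan2024, Conjecture 3 (p. 15)]; product
measure [cite: Grimmett1999, §1.3 p. 10].
-/

noncomputable section

namespace Summit.CriticalPhenomena.PercolationContinuityZ3.Theorems

namespace Quant

open Finset

/-- the two-point law `{lo, hi; g}` (as in `…QuantLawDEC`) -/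
local notation3 "TP[" lo ", " hi ", " g ", " h "]" =>
  (g : ℝ) * (if (h : ℕ) = (hi : ℕ) then (1 : ℝ) else 0) + (1 - (g : ℝ)) * (if (h : ℕ) = (lo : ℕ) then (1 : ℝ) else 0)

namespace LawDec

/-- **CONJECTURE LIGHT-SLICE CORE, LOW-CROSS RESIDUE (census-2 g59).**  In the binder of `LawDec.LightSliceCore` (ordered admissible atom data
on both sides, both atoms window-DEC and not `BDECAtT`, doubly deep, lowest head cell of side 1 not a conv-low, side 1's light segment the
shorter), suppose moreover that the top cell of the light ⊗ cheap piece is a GIANT (`j + 1 ≤ h₁′ + h₂′`) and its upper cross cell is a CONV-LOW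
(`2(h₁′ + l₂′) < T₁ + T₂`).  Then the light slice of side 1 is DEC at `(T₁ + T₂, j)`.  This is the pooled class of the core: the piece
light ⊗ cheap is NOT standalone DEC in 558 / 1 934 such instances (M ≤ 6), the slice is DEC in all (exact LP); census-1 g21/g22's patterns
LMG/LLG with the low cross.  EVIDENCE: every literal test of `LightSliceCore` (census-2 g58 kit j160591: 1 905 682 / 0; j161118 large
geometry 683 246 / 0; lead g27 j161611 superset binder 999 364 / 0). [this work] [status: open] -/
@[conjecture] def LightSliceLowCross : Prop :=
  ∀ (x T₁ T₂ : ℝ) (M₁ M₂ j : ℕ) (l₁ h₁ l₁' h₁' l₂ h₂ l₂' h₂' : ℕ),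
    0 < x → x < 1 → j < M₁ + M₂ →
    AtomData x T₁ j M₁ l₁ h₁ l₁' h₁' → AtomData x T₂ j M₂ l₂ h₂ l₂' h₂' →
    l₁ < l₁' → h₁' ≤ h₁ → l₂ < l₂' → h₂' ≤ h₂ →
    (∀ j'', j'' ≤ j → j ≤ j'' + M₂ → DECAtT x T₁ j'' M₁ (atomLaw x T₁ j l₁ h₁ l₁' h₁')) →
    (∀ j'', j'' ≤ j → j ≤ j'' + M₁ → DECAtT x T₂ j'' M₂ (atomLaw x T₂ j l₂ h₂ l₂' h₂')) →
    ¬ BDECAtT x T₁ j M₁ M₂ (atomLaw x T₁ j l₁ h₁ l₁' h₁') → ¬ BDECAtT x T₂ j M₂ M₁ (atomLaw x T₂ j l₂ h₂ l₂' h₂') →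
    l₁' + h₂' ≤ j → l₂' + h₁' ≤ j →
    T₁ + T₂ ≤ 2 * ((l₁' : ℝ) + h₂') →
    h₁' + l₂' ≤ h₂' + l₁' →
    j + 1 ≤ h₁' + h₂' →
    2 * ((h₁' : ℝ) + l₂') < T₁ + T₂ →
    DECAtT x (T₁ + T₂) j (M₁ + M₂)
      (lconv M₁ M₂ (fun b => TP[l₁', h₁', gateOf x T₁ j l₁' h₁', b]) (atomLaw x T₂ j l₂ h₂ l₂' h₂'))

/-- **CONJECTURE LIGHT-SLICE CORE, WIDE RESIDUE (census-2 g59).**  In the binder of `LawDec.LightSliceCore`, suppose moreover that the top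
cell of the light ⊗ cheap piece is a GIANT (`j + 1 ≤ h₁′ + h₂′`), its upper cross cell is NOT a conv-low (`T₁ + T₂ ≤ 2(h₁′ + l₂′)`), and the
cheap segment of side 2 is MORE THAN 4 TIMES as long as side 1's light segment (`4(h₁′ − l₁′) < h₂′ − l₂′`).  Then the light slice of
side 1 is DEC at `(T₁ + T₂, j)`.  (Arm-2 g31's top-flipped light–light piece needs the aspect bound; the standalone piece fails from
aspect 7 on at floors `x < 0.2955…`, e.g. cells `(0,1)` at target `1/8` and `(0,7)` at `7/8`, `x = 1/5`, `j = 7`; in the core binder 204 / 204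
instances at M ≤ 6 are still piece-wise — the pooled form is the safe statement.)  EVIDENCE: the literal tests of `LightSliceCore` (0 failures,
incl. kit j161118: supports ≤ 36, span ratios up to 30, 683 246 instances). [this work] [status: open] -/
@[conjecture] def LightSliceWide : Prop :=
  ∀ (x T₁ T₂ : ℝ) (M₁ M₂ j : ℕ) (l₁ h₁ l₁' h₁' l₂ h₂ l₂' h₂' : ℕ),
    0 < x → x < 1 → j < M₁ + M₂ →
    AtomData x T₁ j M₁ l₁ h₁ l₁' h₁' → AtomData x T₂ j M₂ l₂ h₂ l₂' h₂' →
    l₁ < l₁' → h₁' ≤ h₁ → l₂ < l₂' → h₂' ≤ h₂ →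
    (∀ j'', j'' ≤ j → j ≤ j'' + M₂ → DECAtT x T₁ j'' M₁ (atomLaw x T₁ j l₁ h₁ l₁' h₁')) →
    (∀ j'', j'' ≤ j → j ≤ j'' + M₁ → DECAtT x T₂ j'' M₂ (atomLaw x T₂ j l₂ h₂ l₂' h₂')) →
    ¬ BDECAtT x T₁ j M₁ M₂ (atomLaw x T₁ j l₁ h₁ l₁' h₁') → ¬ BDECAtT x T₂ j M₂ M₁ (atomLaw x T₂ j l₂ h₂ l₂' h₂') →
    l₁' + h₂' ≤ j → l₂' + h₁' ≤ j →
    T₁ + T₂ ≤ 2 * ((l₁' : ℝ) + h₂') →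
    h₁' + l₂' ≤ h₂' + l₁' →
    j + 1 ≤ h₁' + h₂' →
    T₁ + T₂ ≤ 2 * ((h₁' : ℝ) + l₂') →
    4 * (h₁' - l₁') < h₂' - l₂' →
    DECAtT x (T₁ + T₂) j (M₁ + M₂)
      (lconv M₁ M₂ (fun b => TP[l₁', h₁', gateOf x T₁ j l₁' h₁', b]) (atomLaw x T₂ j l₂ h₂ l₂' h₂'))

end LawDec

end Quant

end Summit.CriticalPhenomena.PercolationContinuityZ3.Theorems
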